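import Summits.ResolutionOfSingularities.ResolutionOfSingularities.Theorems.UniversalCellsCampaignW82FamilyTransferGraded
import Summits.ResolutionOfSingularities.ResolutionOfSingularities.Theorems.UniformComplexityCampaignW82AlgClosureFgKernel
import Mathlib.AlgebraicGeometry.Morphisms.Smooth
import Mathlib.AlgebraicGeometry.Morphisms.Proper
import Mathlib.FieldTheory.PurelyInseparable.Basic
import HarnessLib

/-!
# [OURS · L1 W8.2] The SMOOTH-TWIST form of the perfection step of slot W8.2, pointwise in the
# constant field and graded by dimension (rung B, prime-field / family transfer) — campaign
# statements, Theses-free module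

Cell `res-hironaka` (run/shared/lean/pub/res-hironaka/), LADDER-RESOLUTION rung L (RESCUE), slot W8.2 of
plan/RESCUE-SEED.md («PRIME-FIELD / UNIVERSALITY TRANSFER instead of descent»), host route `UniversalCells`,
host item `PrimeFieldToPerfect` (stmt-ResolutionOfSingularities-15233); second door `UniformComplexity`
`PrimeModelTransfer` (stmt-ResolutionOfSingularities-8933). Statement-only file (written by the slot's prover
res-L1-s82-pv-1, gen 2, for the two-lane desk; the proofs AGAINST these names are in the sibling file
Theorems/UniversalCellsCampaignW82SmoothTwistGradedProofs.lean): four parametric predicates, one graded OURS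
`Prop`, five pure-logic anchors; NOTHING is proved about resolution of singularities here and nothing is
asserted.

WHY THIS FILE. After res-L1-s82-pv-1 (g0) / res-L1-s82-pv-2 / res-L1-type-o6 the whole finite-level part of
slot W8.2 is a theorem (Theorems/UniversalCellsCampaignW82FamilyTransferGradedProofs.lean:
`familyTransferSucc_holds`, `fgFieldTransferShift_holds`) and BOTH door cruxes are reduced BY NAME to the honest
residuals — door 1: `CampaignW82.PerfectionStepDimLe p ⊤` at every prime
(Theorems/UniversalCellsCampaignW82PrimeFieldTransferLinks.lean `primeFieldToPerfect_of_forall_perfectionStepDimLe_top`),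
door 2: `CampaignW82.PerfectionStepAlgClosureFgDimLe p ⊤`
(Theorems/UniformComplexityCampaignW82AlgClosureFgKernelLinks.lean
`primeModelTransfer_of_forall_perfectionStepAlgClosureFgDimLe_top`). All three perfection steps
(`PerfectionStepDimLe` p469608, `PerfectionStepAlgClosedDimLe` p470934, `PerfectionStepAlgClosureFgDimLe`
p475047) have ONE body, POINTWISE in the constant field `M`: «resolution over the finite level `RatFunc M`
in dimension `≤ n` ⇒ resolution over every perfect purely inseparable `L ⊇ RatFunc M` in dimension `≤ n`»,
with `M` ranging over perfect / algebraically closed / relative-algebraic-closure-of-𝔽_p(s) fields. The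
crux documents (Cruxes/PrimeFieldToPerfect/KERNEL.md §2 (E1)–(E2), STRATEGY-CENSUS.md «kernel normal form …
r_F < ∞») describe this residual as EQUIVALENT to a FINITE-LEVEL statement — «some finite purely inseparable
twist of the variety has a SMOOTH proper birational model» — but only one direction is in the tree
(`Theorems.PrimeFieldToPerfect.stub_limitDescent`, p148751: finitely generated ground fields, ungraded); the
converse («E1 ⇒ SmoothTwist … TRUE, Lean XL, NOT landed», KERNEL.md §2/§5) is not. This file names the
pointwise perfection step `PerfectionStepAt M n` (so that the three graded names are `∀ M, PerfectionStepAt M n`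
over their classes of `M`, by `Iff.rfl`) and its finite-level form `SmoothTwistStepAt M n`, so that the sibling
proofs file can land BOTH directions ONCE, pointwise and for EVERY field `M`, and the equivalences
`PerfectionStepDimLe p n ↔ SmoothTwistStepDimLe p n`, `PerfectionStepAlgClosedDimLe p n ↔ ∀ M alg. closed,
SmoothTwistStepAt M n`, `PerfectionStepAlgClosureFgDimLe p n ↔ …` at every grade: the residual of slot W8.2,
on either door, is EXACTLY the selection/termination problem «r_F < ∞» of the Frobenius-root climb.

CONTENT (non-embedded summit idiom `Scheme.HasResolution` / `IsBirational`, ground field passed explicitly as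
`f₀ : X₀ ⟶ Spec K`, Mathlib `Smooth`, `IsProper`, `IsPurelyInseparable`, `Module.Finite`, `PerfectField`;
dimension = `topologicalKrullDim` of the carrier with values in `WithBot ℕ∞` as in the graded kernel):

* `IntegralOverPerfectClosure K f₀` — the HYPOTHESIS SHAPE of the registered kernel stub `stub_smoothTwist`
  of stmt-15233 (Cruxes/PrimeFieldToPerfect/Lines/birth.lean), as a named predicate: `X₀ ×_K L` is integral
  for SOME perfect purely inseparable `L ⊇ K` (all such `L` are `K`-isomorphic to `K^{perf}`; for `X₀` of
  finite type: `X₀` irreducible and geometrically reduced — geometric irreducibility is NOT asked). The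
  disprover's landed Negative lemma `Theorems.PrimeFieldToPerfect.Negative.smoothTwist_false_without_geomIntegral`
  (all `p`) shows this hypothesis cannot be weakened to «`X₀` integral».
* `HasSmoothModelAtFiniteLevel K f₀` — the CONCLUSION SHAPE of the same stub: for some FINITE purely
  inseparable `K' ⊇ K` there is a proper birational `π : Y ⟶ X₀ ×_K K'` with `Y ⟶ Spec K'` SMOOTH. By
  `Theorems.PrimeFieldToPerfect.Negative.hasResolution_level_of_smoothModel` such a model base-changes to a
  resolution of `X₀ ×_K F` over EVERY further field `F ⊇ K'`.
* `PerfectionStepAt M n` — the perfection step at ONE constant field `M` (the common body of the three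
  lane-signed graded names; anchors `perfectionStepDimLe_iff_forall`, `perfectionStepAlgClosedDimLe_iff_forall`,
  `perfectionStepAlgClosureFgDimLe_iff_forall`, all `Iff.rfl`).
* `SmoothTwistStepAt M n` — THE SMOOTH-TWIST STEP at one constant field `M`: given resolution of integral
  separated schemes of finite type of dimension `≤ n` over `RatFunc M`, every separated `X₀` of finite type
  and dimension `≤ n` over a FINITE purely inseparable extension `K` of `RatFunc M` (a finite level
  `M(t^{1/p^e})` when `M` is perfect) with `IntegralOverPerfectClosure K f₀` satisfies
  `HasSmoothModelAtFiniteLevel K f₀`. The level `K` is quantified (rather than fixed to `RatFunc M`) because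
  limit descent from `L ≅ M(t)^{perf}` lands at SOME finite level; it is required FINITE over `RatFunc M`
  because at `K = L` the statement would contain `PerfectionStepAt M n` as a literal instance.
* `SmoothTwistStepDimLe p n := ∀ M perfect of characteristic p, SmoothTwistStepAt M n` — the door-1 graded
  name, sibling of `PerfectionStepDimLe p n`; the door-2 forms are written `∀ M …, SmoothTwistStepAt M n` over
  o6's two classes and need no further name.
* anchors (pure logic, `Iff.rfl`): the three `…_iff_forall` above, `hasSmoothModelAtFiniteLevel_iff` (the
  predicate unfolds to the inlined binder block of the registered stub) and `smoothTwistStepDimLe_iff_forall`.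

THEOREMS-TO-PROVE (names fixed here, proofs in the sibling file by res-L1-s82-pv-1, for EVERY field `M` —
neither perfectness nor the characteristic is used): `smoothTwistStepAt_of_perfectionStepAt` (E1 ⇒
SmoothTwist: resolve over `L`, regular over perfect = smooth, DESCEND the smooth proper birational model to a
finite level by `Theorems.stub_descendResolutionData` (p99203, Görtz–Wedhorn I Thm. 10.63/10.66) and fpqc
descent of `Smooth` / `IsBirational` along the radicial `X₀ ×_K L → X₀ ×_K K'`),
`perfectionStepAt_of_smoothTwistStepAt` (limit descent: EGA IV₃ 8.8.2 (ii) + base change of the smooth model,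
the mechanism of p148751 with dimension bookkeeping `topologicalKrullDim_eq_of_isPullback`), hence
`perfectionStepAt_iff_smoothTwistStepAt` and the three graded equivalences.

HONEST FRAMING. The `def`s below are OURS — campaign statements that REPLACE THE ROLE of a printed item of
H. Hironaka's manuscript *Resolution of singularities in positive characteristics* (2017-03-23, [Hironaka2017],
lit key `paper:url-3343fd9e678b`) — namely §17 ¶2, p.89 l.59–62 («In this work the base field K is always
assumed to be a finite field or Z/pZ because our resolution is for all dimension. When the K has
transcendence degree d we can reformulate the resolution problem to the case of dimension d + dim Z.», typed
AS PRINTED as `Literature.AlgebraicGeometry.Hironaka2017.S17Methodology.U89_3`, and under the §2 p.4 l.22–24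
reading «a perfect base field K» as `U89_3_ours`; quotes and locators as in the lane-signed sibling p469608,
layout lines p.89 L28–L31 / p.4 L21–L23) at transcendence degree one for a PERFECT target field
`M(t)^{perf}`: the printed reformulation silently needs a model that stays regular under `t ↦ t^{1/p}`, and
`SmoothTwistStepAt` is the precise finite-level statement of that need. NOT statements of the manuscript;
nothing here is attributed to its author; no typed candidate of the manuscript is used even as a hypothesis.
AI transcription, weaker than expert review.

BUILD RULE (cell, director-resolution 2026-08-26T18:53:29Z (B)): OURS vocabulary file, THESES-FREE BY BIRTH —
imports only the Theses-free modules p469608 (door 1, cone p466046) and p475047 (door 2, cone p470934), three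
Mathlib morphism-property / field-theory modules and `HarnessLib`.

BARRIERS (catalogued under `Literature/Barriers/ResolutionOfSingularities/`, namespace
`Literature.Barriers.ResolutionOfSingularities`): `SmoothTwistStepAt M n` sits exactly ON the three transport
barriers of the slot — file `RegularNotGeometricallyRegular.lean` (a regular model over a finite level need not
be smooth: the statement ASKS for smoothness, at a deeper finite level), file `FrobeniusTwistResolution.lean`
decl `not_hasResolution_Spec_frobTwist` and file `InseparableBaseChangeResolution.lean` decls
`not_hasResolution_Spec_dualNumber` / `not_hasResolution_pullback_extField` (no transport of
`Scheme.HasResolution` along `K → K^{1/p}`: the statement transports a SMOOTH model, which is legitimate —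
`hasResolution_level_of_smoothModel`). It does not evade them; it names what crossing them at grade `n` means.
Open-problem grade for `n ≥ 4` exactly like the perfection steps (they are equivalent); a theorem for `n ≤ 3`
(through the equivalence and `perfectionStepDimLe_of_le_three`, conditional on FACT-LIST F-02
`CossartPiltant2019`), unconditional for `n ≤ 1`.

VACUITY SELF-CHECK (one line per decl in the docstrings): `IntegralOverPerfectClosure K f₀` is false for empty
`X₀` and for `X₀ = Spec K(t^{1/p})` over `K = 𝔽_p(t)` (Negative lemma), true for `X₀ = Spec K`;
`HasSmoothModelAtFiniteLevel K f₀` is false for `X₀ = Spec K(t^{1/p})` over every level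
(`no_smoothModel_inseparablePoint`), true for `X₀` smooth over `K`; `PerfectionStepAt M n` /
`SmoothTwistStepAt M n` are trivially true exactly at `n = ⊥` (integral schemes are nonempty), trivially true
for PERFECT `RatFunc M` — i.e. never for a field `M` (`t` has no `p`-th root) except in characteristic `0`,
where «purely inseparable» means «trivial» and both say nothing (not intended) —, never trivially false in
characteristic `p` (every instance follows from `ResolutionInChar p`); `SmoothTwistStepDimLe p n` for prime `p`:
as `PerfectionStepDimLe p n` (equivalent); composite `p > 1` admits no field of characteristic `p` (vacuous).

## References (vocabulary and locators only; nothing cited as a premise)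
* H. Hironaka, ms. 2017-03-23, §17 ¶2 p.89 l.59–62; §2 p.4 l.22–24 — under adjudication, quoted for the
  role replaced, not asserted. [Hironaka2017]
* A. Grothendieck, J. Dieudonné, EGA IV₃ (1966) Thm. 8.8.2 (ii), 8.10.5; EGA IV₄ (1967) Prop. 17.7.8 — the
  tools behind the sibling proofs, not used in this file. [EGAIV3]
* U. Görtz, T. Wedhorn, *Algebraic Geometry I*, 2nd ed. (2020), Thm. 10.63, Thm. 10.66 — idem. [GortzWedhorn2020]
* Cruxes/PrimeFieldToPerfect/KERNEL.md §2 (E1)–(E3), §5; STRATEGY-CENSUS.md (line `frobenius-root-climb`,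
  invariant `r_F`); L/res-L1-k82/KILL-TEST-K8.2.md §4; L/res-L1-s82-pv-2/DOOR2-KERNEL.md; plan/RESCUE-SEED.md
  row W8.2 — cell files, OURS.
-/

noncomputable section

set_option linter.dupNamespace false -- mandated namespace of this single-conjunct summit

open _root_.CategoryTheory _root_.CategoryTheory.Limits _root_.AlgebraicGeometry
open Literature.AlgebraicGeometry.Resolution

namespace Summit.ResolutionOfSingularities.ResolutionOfSingularities.Theorems.CampaignW82

universe u

/-! ## The two shapes of the registered kernel stub, as named predicates -/

/-- [OURS · L1 W8.2] replaces the role of §17 ¶2, p.89 l.59–62 read with §2 p.4 l.22–24 («a perfect base field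
K»; typed as `S17Methodology.U89_3_ours`) by naming the HYPOTHESIS under which a variety over a finite level
`K` can be moved to the perfect field `K^{perf}` without losing integrality; NOT a statement of the manuscript.
INTEGRAL OVER THE PERFECT CLOSURE: for a field `K` and `f₀ : X₀ ⟶ Spec K`, the base change `X₀ ×_K Spec L` is
an integral scheme for SOME perfect field `L` purely inseparable over `K` (every such `L` is `K`-isomorphic to
the perfect closure `K^{perf}`, so «some» = «every»; for `X₀` of finite type this says: `X₀` is irreducible
and geometrically reduced — geometric irreducibility is NOT asked). This is, binder for binder, the
hypothesis of the registered stub `stub_smoothTwist` of stmt-15233 and of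
`Theorems.PrimeFieldToPerfect.stub_limitDescent` (p148751). Vacuity: false for empty `X₀` (an integral scheme
is nonempty) and for `X₀ = Spec 𝔽_p(t^{1/p})` over `𝔽_p(t)`
(`Theorems.PrimeFieldToPerfect.Negative.not_isReduced_tensor_of_pthRoots`); true for `X₀ = Spec K`; for
perfect `K` it says `X₀` is integral (`L = K`). [folklore] -/
def IntegralOverPerfectClosure (K : Type u) [Field K] {X₀ : Scheme.{u}} (f₀ : X₀ ⟶ Spec (.of K)) : Prop :=
  ∃ (L : Type u) (_ : Field L) (_ : PerfectField L) (_ : Algebra K L) (_ : IsPurelyInseparable K L),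
    IsIntegral (pullback f₀ (Spec.map (CommRingCat.ofHom (algebraMap K L))))

/-- [OURS · L1 W8.2] replaces the role of §17 ¶2, p.89 l.59–62 read with §2 p.4 l.22–24 («a perfect base field
K»; typed as `S17Methodology.U89_3_ours`) by naming WHAT A FINITE LEVEL MUST SUPPLY for the printed
reformulation to reach the perfect field `K^{perf}`: a model that is SMOOTH, not merely regular; NOT a
statement of the manuscript. A SMOOTH MODEL AT A FINITE LEVEL: for a field `K` and `f₀ : X₀ ⟶ Spec K` there are
a FINITE purely inseparable extension `K' ⊇ K` (`Module.Finite K K'`, `IsPurelyInseparable K K'`), a scheme `Y`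
and a proper birational `π : Y ⟶ X₀ ×_K Spec K'` (`IsProper`, tree `IsBirational`) whose composite with the
projection `Y ⟶ Spec K'` is `Smooth`. This is, binder for binder, the conclusion of the registered stub
`stub_smoothTwist` of stmt-15233 (`hasSmoothModelAtFiniteLevel_iff`, `Iff.rfl`). Such a model base-changes to a
resolution of `X₀ ×_K F` for every field `F ⊇ K'`
(`Theorems.PrimeFieldToPerfect.Negative.hasResolution_level_of_smoothModel`), in particular over `K^{perf}` —
which a merely REGULAR model does not (barrier file `RegularNotGeometricallyRegular.lean`). Vacuity: false for
`X₀ = Spec 𝔽_p(t^{1/p})` over `𝔽_p(t)` at every level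
(`Theorems.PrimeFieldToPerfect.Negative.no_smoothModel_inseparablePoint`); true whenever `X₀ ⟶ Spec K` is
itself smooth (level `K' = K`, `Y = X₀ ×_K Spec K`, `π = 𝟙`); does not imply irreducibility of `X₀` (a smooth
`Y` may be disconnected). [folklore] -/
def HasSmoothModelAtFiniteLevel (K : Type u) [Field K] {X₀ : Scheme.{u}} (f₀ : X₀ ⟶ Spec (.of K)) : Prop :=
  ∃ (K' : Type u) (_ : Field K') (_ : Algebra K K') (_ : IsPurelyInseparable K K') (_ : Module.Finite K K')
    (Y : Scheme.{u}) (π : Y ⟶ pullback f₀ (Spec.map (CommRingCat.ofHom (algebraMap K K')))),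
    IsProper π ∧ IsBirational π ∧
      Smooth (π ≫ pullback.snd f₀ (Spec.map (CommRingCat.ofHom (algebraMap K K'))))

/-! ## The perfection step and the smooth-twist step at ONE constant field -/

/-- [OURS · L1 W8.2] replaces the role of §17 ¶2, p.89 l.59–62 («When the K has transcendence degree d we can
reformulate the resolution problem to the case of dimension d + dim Z») read with §2 p.4 l.22–24 («a perfect
base field K»; typed as `S17Methodology.U89_3_ours`) at transcendence degree one, POINTWISE IN THE CONSTANT
FIELD `M` and GRADED BY DIMENSION; NOT a statement of the manuscript. THE PERFECTION STEP AT `M`, grade `n`: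
if every integral separated scheme of finite type of dimension `≤ n` over `RatFunc M` has a resolution, then so
does every integral separated scheme of finite type of dimension `≤ n` over every PERFECT field `L` purely
inseparable over `RatFunc M` (for perfect `M`: `L ≅ M(t)^{perf}`). This is the common body of the three
lane-signed graded residuals of slot W8.2 — `PerfectionStepDimLe p n = ∀ M perfect of char p`,
`PerfectionStepAlgClosedDimLe p n = ∀ M algebraically closed of char p`, `PerfectionStepAlgClosureFgDimLe p n =
∀ M = (𝔽_p(s))^{alg} ∩ K` — binder for binder (`perfectionStepDimLe_iff_forall`,
`perfectionStepAlgClosedDimLe_iff_forall`, `perfectionStepAlgClosureFgDimLe_iff_forall`, all `Iff.rfl`); it is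
named so that the equivalence with the smooth-twist step is proved ONCE for every `M`. Vacuity: trivially true
at `n = ⊥` (integral schemes are nonempty) and in characteristic `0` (purely inseparable = trivial; not
intended); for `M` of characteristic `p` never trivially false (follows from `ResolutionInChar p`), open for
`n ≥ 4`, a theorem for `n ≤ 3` from FACT-LIST F-02; NOT monotone in `n`. [folklore] -/
def PerfectionStepAt (M : Type) [Field M] (n : WithBot ℕ∞) : Prop :=
  (∀ (X : Scheme.{0}) (f : X ⟶ Spec (.of (RatFunc M))),
      IsSeparated f → LocallyOfFiniteType f → QuasiCompact f → IsIntegral X →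
        topologicalKrullDim X ≤ n → Scheme.HasResolution X) →
    ∀ (L : Type) [Field L] [PerfectField L] [Algebra (RatFunc M) L] [IsPurelyInseparable (RatFunc M) L]
      (X : Scheme.{0}) (f : X ⟶ Spec (.of L)),
      IsSeparated f → LocallyOfFiniteType f → QuasiCompact f → IsIntegral X →
        topologicalKrullDim X ≤ n → Scheme.HasResolution X

/-- [OURS · L1 W8.2] replaces the role of §17 ¶2, p.89 l.59–62 («When the K has transcendence degree d we can
reformulate the resolution problem to the case of dimension d + dim Z») read with §2 p.4 l.22–24 («a perfect
base field K»; typed as `S17Methodology.U89_3_ours`) at transcendence degree one, in its FINITE-LEVEL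
(smooth-twist) form, POINTWISE IN THE CONSTANT FIELD `M` and GRADED BY DIMENSION; NOT a statement of the
manuscript. THE SMOOTH-TWIST STEP AT `M`, grade `n`: if every integral separated scheme of finite type of
dimension `≤ n` over `RatFunc M` has a resolution (the hypothesis block of `PerfectionStepAt M n`, verbatim),
then for every FINITE purely inseparable extension `K` of `RatFunc M` (for perfect `M`: a finite level
`M(t^{1/p^e})`, as a field isomorphic to `RatFunc M`) and every separated `f₀ : X₀ ⟶ Spec K` of finite type with
`topologicalKrullDim X₀ ≤ n` and `IntegralOverPerfectClosure K f₀` one has `HasSmoothModelAtFiniteLevel K f₀`: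
after a further FINITE purely inseparable extension the variety acquires a proper birational model SMOOTH over
the ground field. EQUIVALENT to `PerfectionStepAt M n` for every field `M` (sibling proofs file,
`perfectionStepAt_iff_smoothTwistStepAt`; «⇐» is limit descent as in
`Theorems.PrimeFieldToPerfect.stub_limitDescent`, «⇒» is descent of a smooth resolution over the perfect `L` to a
finite level) — so this is the slot's residual in the form «the Frobenius-root climb terminates»
(Cruxes/PrimeFieldToPerfect/STRATEGY-CENSUS.md, `r_F < ∞`), neither stronger nor weaker. The level `K` is
quantified because limit descent lands at SOME finite level; it is kept FINITE over `RatFunc M` because at a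
perfect `K` the statement would contain `PerfectionStepAt M n` literally. Vacuity: trivially true exactly at
`n = ⊥` (an integral `X₀ ×_K L` is nonempty, hence so is `X₀`, and `topologicalKrullDim X₀ ≤ ⊥` fails) and in
characteristic `0` (not intended); for `M` of characteristic `p` never trivially false (follows from
`ResolutionInChar p` through the equivalence), open for `n ≥ 4`, a theorem for `n ≤ 3` (F-02); NOT monotone in
`n`. [folklore] -/
def SmoothTwistStepAt (M : Type) [Field M] (n : WithBot ℕ∞) : Prop :=
  (∀ (X : Scheme.{0}) (f : X ⟶ Spec (.of (RatFunc M))),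
      IsSeparated f → LocallyOfFiniteType f → QuasiCompact f → IsIntegral X →
        topologicalKrullDim X ≤ n → Scheme.HasResolution X) →
    ∀ (K : Type) [Field K] [Algebra (RatFunc M) K] [IsPurelyInseparable (RatFunc M) K]
      [Module.Finite (RatFunc M) K] (X₀ : Scheme.{0}) (f₀ : X₀ ⟶ Spec (.of K)),
      IsSeparated f₀ → LocallyOfFiniteType f₀ → QuasiCompact f₀ → topologicalKrullDim X₀ ≤ n →
        IntegralOverPerfectClosure K f₀ → HasSmoothModelAtFiniteLevel K f₀

/-! ## The door-1 graded name -/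

/-- [OURS · L1 W8.2] replaces the role of §17 ¶2, p.89 l.59–62 read with §2 p.4 l.22–24 («a perfect base field
K»; typed as `S17Methodology.U89_3_ours`) at transcendence degree one for the target field `M(t)^{perf}`, in its
FINITE-LEVEL (smooth-twist) form and GRADED BY DIMENSION — the sibling of `PerfectionStepDimLe p n`; NOT a
statement of the manuscript. THE GRADED SMOOTH-TWIST STEP at `p`, grade `n`: `SmoothTwistStepAt M n` for every
PERFECT field `M` of characteristic `p`. EQUIVALENT to `PerfectionStepDimLe p n` (sibling proofs file,
`perfectionStepDimLe_iff_smoothTwistStepDimLe`). Rungs (via the equivalence, not proved here): `n ≤ 1`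
unconditional, `n ≤ 3` from FACT-LIST F-02 (`CossartPiltant2019`), `n = 4` the first open rung of slot W8.2.
Vacuity (prime `p`): trivially true exactly at `n = ⊥`; never trivially false (every instance follows from
`ResolutionInChar p` through the equivalence); NOT monotone in `n`; composite `p > 1` admits no field of
characteristic `p` (vacuous); `p = 0` not intended (purely inseparable = trivial there). [folklore] -/
def SmoothTwistStepDimLe (p : ℕ) (n : WithBot ℕ∞) : Prop :=
  ∀ (M : Type) [Field M] [CharP M p] [PerfectField M], SmoothTwistStepAt M n

/-! ## Pure-logic anchors -/

/-- **Door 1's graded residual is the pointwise perfection step over perfect `M`** (definitional,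
`Iff.rfl`): `PerfectionStepDimLe p n ↔ ∀ M perfect of characteristic p, PerfectionStepAt M n`. [folklore] -/
theorem perfectionStepDimLe_iff_forall (p : ℕ) (n : WithBot ℕ∞) :
    PerfectionStepDimLe p n ↔
      ∀ (M : Type) [Field M] [CharP M p] [PerfectField M], PerfectionStepAt M n :=
  Iff.rfl

/-- **Door 2's graded residual (v1, p470934) is the pointwise perfection step over algebraically closed
`M`** (definitional, `Iff.rfl`). [folklore] -/
theorem perfectionStepAlgClosedDimLe_iff_forall (p : ℕ) (n : WithBot ℕ∞) :
    PerfectionStepAlgClosedDimLe p n ↔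
      ∀ (M : Type) [Field M] [CharP M p] [IsAlgClosed M], PerfectionStepAt M n :=
  Iff.rfl

/-- **Door 2's sharpest graded residual (p475047) is the pointwise perfection step at the countably many
constant fields `M = (𝔽_p(s))^{alg} ∩ K`** (`K` algebraically closed of characteristic `p`, `s ⊆ K` finite;
definitional, `Iff.rfl`). [folklore] -/
theorem perfectionStepAlgClosureFgDimLe_iff_forall (p : ℕ) (n : WithBot ℕ∞) :
    PerfectionStepAlgClosureFgDimLe p n ↔
      ∀ (K : Type) [Field K] [CharP K p] [IsAlgClosed K] (s : Finset K),
        PerfectionStepAt (algebraicClosure (Subfield.closure (↑s : Set K)) K) n :=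
  Iff.rfl

/-- **The door-1 graded smooth-twist step is the pointwise one over perfect `M`** (definitional,
`Iff.rfl`). [folklore] -/
theorem smoothTwistStepDimLe_iff_forall (p : ℕ) (n : WithBot ℕ∞) :
    SmoothTwistStepDimLe p n ↔
      ∀ (M : Type) [Field M] [CharP M p] [PerfectField M], SmoothTwistStepAt M n :=
  Iff.rfl

/-- **The conclusion predicate is the registered stub's conclusion, inlined** (definitional, `Iff.rfl`):
`HasSmoothModelAtFiniteLevel K f₀` unfolds to the `∃ K' … Y π, IsProper π ∧ IsBirational π ∧ Smooth (π ≫ pr₂)`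
block of `stub_smoothTwist` (stmt-15233) / of the hypothesis `h` of
`Theorems.PrimeFieldToPerfect.stub_limitDescent`. [folklore] -/
theorem hasSmoothModelAtFiniteLevel_iff (K : Type u) [Field K] {X₀ : Scheme.{u}}
    (f₀ : X₀ ⟶ Spec (.of K)) :
    HasSmoothModelAtFiniteLevel K f₀ ↔
      ∃ (K' : Type u) (_ : Field K') (_ : Algebra K K') (_ : IsPurelyInseparable K K')
        (_ : Module.Finite K K') (Y : Scheme.{u})
        (π : Y ⟶ pullback f₀ (Spec.map (CommRingCat.ofHom (algebraMap K K')))),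
        IsProper π ∧ IsBirational π ∧
          Smooth (π ≫ pullback.snd f₀ (Spec.map (CommRingCat.ofHom (algebraMap K K')))) :=
  Iff.rfl

end Summit.ResolutionOfSingularities.ResolutionOfSingularities.Theorems.CampaignW82

end
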